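import Summits.BirchSwinnertonDyer.BirchSwinnertonDyer.Theorems.CountingDoorF2AtThreeSelmerAverageSieve
import Literature.NumberTheory.EllipticCurves.BhargavaHo2022.LargeFamilyEulerProduct
import HarnessLib

/-!
# BirchSwinnertonDyer / CountingDoorF2AtThree — crux I1 `SelmerThreeAverageLargeF2`
# (stmt-BirchSwinnertonDyer-19440): the squarefree-sieve tail DISCHARGED BY NAME — I1 is EQUIVALENT to
# its finitely-conditioned case modulo one printed theorem

Route `route-BirchSwinnertonDyer-CountingDoorF2AtThree` (cell bsd-rank2; TWIN leaf
`PAdicBSDRankTwoPositiveProportion`). The tree's sieve reduction for I1,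
`Theorems.selmerThreeAverageLargeF2_of_finiteConditions` (file
`CountingDoorF2AtThreeSelmerAverageSieve.lean`), concludes the route decl `SelmerThreeAverageLargeF2`
(«`avg #Sel₃ ≤ 36` on every large subfamily of `F₂`») from (i) the same bound on every subfamily with
FINITELY many congruence conditions, (ii) an ad-hoc hypothesis `htail` (the `p² ∣ Δ` tail estimate)
and (iii) Bhargava–Ho's Thm. 9.1 as `thm9_1_F2`. (ii) and (iii) are COROLLARIES of ONE printed theorem,
Bhargava–Ho's Thm. 9.1 for `F₂` WITH ITS EULER-PRODUCT CONSTANT — the named fact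
`Literature.NumberTheory.EllipticCurves.BhargavaHo2022.thm9_1_F2_eulerProduct`
(`BhargavaHo2022/LargeFamilyEulerProduct.lean`: `.tail_estimate` = `htail` verbatim, `.thm9_1` =
`thm9_1_F2`). Hence:

* `selmerThreeAverageLargeF2_of_finiteConditions'` — I1 ⟸ (i), modulo the one printed fact;
* `selmerThreeAverageLargeF2_iff_finiteConditions` — modulo that fact, I1 is EQUIVALENT to its case
  of finitely many congruence conditions (the converse is the tree's
  `selmerThreeAverage_finiteConditions_of_largeF2`, fact-free).

HONEST STATUS: (i) is OPEN (it is Bhargava–Ho's orbit-counting programme for `(F₂, 3)` with the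
uniformity estimate in boxes; lane census `IDEATION-CENSUS` of crux I1); I1 is NOT proved. PARTITION:
none — r_an ≥ 2, summit axis S0; TWIN (D-0056): n/a. B1 honesty: counting bookkeeping; the Selmer
group enters only as the averaged quantity; no analytic rank, no `L`-value; no S0 motion.

References: M. Bhargava, W. Ho, arXiv:2207.03309 (2022) §9.1 Thm. 9.1, Prop. 9.2, §9.2 Thm. 9.6
[BhargavaHo2022]; M. Bhargava, A. Shankar, Ann. of Math. 181 (2015) §2.7 [BhargavaShankarAnnals2015].
-/

set_option linter.dupNamespace false

noncomputable section

open scoped Classical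
open Filter Topology Finset
open Literature.NumberTheory.EllipticCurves.BhargavaHo2022
  Summit.BirchSwinnertonDyer.Rank2
  Summit.BirchSwinnertonDyer.BirchSwinnertonDyer.Theses.CountingDoorF2AtThree

namespace Summit.BirchSwinnertonDyer.BirchSwinnertonDyer.Theorems

/-- **I1 from I1 on finitely-conditioned families**, modulo ONLY Bhargava–Ho's Thm. 9.1 with its
constant: if every subfamily `Ψ ⊆ F₂` with finitely many congruence conditions satisfies
`avg #Sel₃ ≤ 36` (`AverageOnLE`), then `SelmerThreeAverageLargeF2` — the tree's
`selmerThreeAverageLargeF2_of_finiteConditions` with its hypotheses `thm9_1_F2` and `htail` DISCHARGED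
by `thm9_1_F2_eulerProduct.thm9_1` and `thm9_1_F2_eulerProduct.tail_estimate`.
[cite: BhargavaHo2022, Thm. 9.1, Prop. 9.2, Thm. 9.6 (§9)] -/
theorem selmerThreeAverageLargeF2_of_finiteConditions' (h : thm9_1_F2_eulerProduct)
    (hfin : ∀ Ψ : CongruenceFamily₂, (∃ Y : ℕ, ∀ p : ℕ, Y ≤ p → Ψ.residues p = Set.univ) →
      Ψ.AverageOnLE (fun a ↦ (Nat.card (a.curve.selmerGroup 3) : ℝ)) 36) :
    SelmerThreeAverageLargeF2 :=
  selmerThreeAverageLargeF2_of_finiteConditions (thm9_1_F2_eulerProduct.thm9_1 h)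
    (thm9_1_F2_eulerProduct.tail_estimate h) hfin

/-- **Modulo Bhargava–Ho's Thm. 9.1 with its constant, crux I1 is EQUIVALENT to its case of finitely
many congruence conditions**: `SelmerThreeAverageLargeF2 ↔ ∀ Ψ` with no condition at the primes
`p ≥ Y` (some `Y`), `Ψ.AverageOnLE #Sel₃ 36`. (→ is fact-free: such `Ψ` are large.)
[cite: BhargavaHo2022, Thm. 9.1, Prop. 9.2, Thm. 9.6 (§9)] -/
theorem selmerThreeAverageLargeF2_iff_finiteConditions (h : thm9_1_F2_eulerProduct) :
    SelmerThreeAverageLargeF2 ↔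
      ∀ Ψ : CongruenceFamily₂, (∃ Y : ℕ, ∀ p : ℕ, Y ≤ p → Ψ.residues p = Set.univ) →
        Ψ.AverageOnLE (fun a ↦ (Nat.card (a.curve.selmerGroup 3) : ℝ)) 36 :=
  ⟨fun hI1 Ψ hY ↦ selmerThreeAverage_finiteConditions_of_largeF2 hI1 Ψ hY,
    selmerThreeAverageLargeF2_of_finiteConditions' h⟩

end Summit.BirchSwinnertonDyer.BirchSwinnertonDyer.Theorems

end
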